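import Summits.QuantumFields.BalabanUV.T4Continuum.Support.TermwiseLocalProfile
import Summits.QuantumFields.BalabanUV.T4Continuum.Support.TermwiseHolderNorm

/-!
# TermwiseLocalReg — the term-wise `U(N)` ledger theorem with the background binder in the PRINTED HÖLDER CURRENCY
PER WINDOW AT THE WINDOW's LEVEL: `HolderReg` on the window box `Δ(p′_y)` at spacing `(L^{lvl y})⁻¹` ⇒ the local
(44)/(44∇) of `Support/TermwiseLocalLedger` ⇒ `GoodClause ∧ Summable δ⁗` (record (20l)(γ)(i) completed)

Cell `pub-balaban`, rung (B)+1 sub-cell t4, lineage `b2b-balaban-t4-ne7-p1` (node U5 = NE7, TERM-WISE member;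
generation 17), record `t4/T4-EST-NE7-P1.md` §23.  HONEST FRAMING (page 1): FIXED FINITE T⁴, rung (B)+1 = the
`ε → 0` limit of unit-scale averaged expectations, CONDITIONAL on BetaPertH and the nine spine estimates (0/9 proved);
NOT infinite volume, NOT a mass gap, NOT the Clay problem.  NE7 is NOT PRINTED in
[Balaban1984PropagatorsI]–[Balaban1989LargeFieldII] and NOT proved here: every estimate below is a HYPOTHESIS BINDER
named in the statement; the flow window (0.31) of [Balaban1987RG1] enters BY NAME as `h031A`/`h031B`; (B)/(B^μ) sit
by name inside the producers of the upstream ledger kinds; nothing is hidden in a definition.  [folklore] bookkeeping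
over generation 14–16's `LocReg`/`HolderReg`/`binders_of_locRegProfile`/`profile_holder` and this generation's
`TermwiseLocalProfile`; no definitions, no cite tags; nothing printed is asserted.

THE POINT.  Generations 14–16 typed the background input of the term-wise chain as ONE local regularity binder per
SITE in the printed currency — `HolderReg V z 6 η (a₀ε₁) (a₁ε₁) β₀ (a₂ε₁)` = [Balaban1985Variational] Theorem 1 (9)
(«|A| < B₃Mε₁(L^jη)^{−1}, |∇^ηA| < B₃Mε₁(L^jη)^{−2}, ‖A‖_{1,β} < B₄(β₀)Mε₁(L^jη)^{−2−β}», the tree's `B11.Regularity`)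
read with [Balaban1985BackgroundPropagators] (3.40) at `U₀ = 1` — but at the UNIFORM spacing `η = (L^K)⁻¹`, i.e. for
the all-small-field history.  Print states (9) PER LEVEL: on the cubes of `Ω_j` the bounds carry `(L^jη)^{−1}`,
`(L^jη)^{−2}`, `(L^jη)^{−2−β}` — in unit-index variables on the
`L^{−K}`-lattice this is EXACTLY `HolderReg` at the spacing `(L^j)⁻¹` OF THE LEVEL — all three clauses: with
`B = ηA`, `η = (L^K)⁻¹`, `t = (L^jη)⁻¹ = L^{K−j}`, one has `η·(B₃Mε₁t) = (L^j)⁻¹·B₃Mε₁`, `η²·(B₃Mε₁t²) =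
((L^j)⁻¹)²·B₃Mε₁` and `η²·B₄Mε₁t^{2+β}·(η|x′−x|)^β = ((L^j)⁻¹)²·B₄Mε₁·((L^j)⁻¹|x′−x|)^β` (kernel: companion
`Support/TermwiseLocalThm1`, `HolderReg.rescale` / `holderReg_level_of_thm1At`: the typed Theorem 1 at a cube of level
`j` delivers the binder below from a PER-LEVEL covering; v1 of this docstring wrongly called the size clause «weaker by
`L^{K−j}`» — it is not, (9) has `(L^jη)^{−1}` for `|A|`).  With the per-window localisation of the one-level binders
(`TermwiseLocalBinders`), the level-graded producer with a Hölder profile (`TermwiseLocalProfile`) and generation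
16's per-site dictionary `HolderReg.locReg_level`, the ledger now takes `HolderReg` at spacing `(L^{lvl y})⁻¹` at every
site of the window box of every window `y` (and at run B's fine plaquettes).

WHAT IS PROVED ([folklore]).
§8 `plaq_le_of_locReg_level`, `osc_le_of_locReg_level` — generation 14/15's (44)/(44∇) dictionary AT ONE SITE with
   the radii of level `j` (`|V(∂p_x) − 1| ≤ cReg·ε₁·L^{−2j}`; covariant one-bond oscillation
   `≤ (4a₂ + 100a₀a₁ + 132a₀³)·ε₁·L^{−2j}·ϑ^j` when `L^{−j} ≤ ϑ^j`); `laws_of_locRegProfile` — the per-level smallness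
   and the (44∇) law with `c_{α1} = cOscReg` (generation 15's arithmetic, read off at a vacuous term class).
§9 **`goodClause_summable_UN_levels_of_holderReg`** — `TermwiseLocal.goodClause_summable_UN_levels` with (44-loc)
   `hA hB hBf`, (44∇-loc) `hAosc`, `hαlev hdecay hα₁lev` DISCHARGED from `hA9W`/`hB9W`/`hB9F` (`HolderReg` per window /
   per fine plaquette at the level's spacing) via `HolderReg.locReg_level`, §8, `profile_holder` (`ϑ = L^{−β₀}`) and
   `interpolation_averaging_UN_levels_profile`; ONE CALL of generation 9's `goodClause_summable_of_kindsRA_lift`.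

BINDER CENSUS of §9 (every one a hypothesis; which are estimates).  Generation 9's ledger binders VERBATIM
((T)(B-T)(R-T)(F)(F′)(S)(M)(M-B)(B-adm)(B-win)(N)(Q)(R-sc)(M-R)(R-S)(0.31)(min-A)(Q)(lift)(min-B)(act)(γ)(R-w)(W-w));
(repr) `hreprU hreprL`; `hMvol`; `2 ≤ M`, `2 ≤ L`, genuine planes; and for the background:
(lvl) `lvlA lvlB lvlBf` — level maps (DATA of the history; U5a/U5c); (win) `hwinA hwinB hwinBf` — the window clause
  with the cut of (B-win) (interface I-3, a DEFINITION of the bad class, paid by NE7b);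
(U) `hAU hBU` — unitarity and `M·L^{K+1}`-periodicity of both runs' backgrounds (format);
(9-W) `hA9W hB9W` — `HolderReg (V· K t τ v) x 6 (L^{lvl y})⁻¹ (a₀ε₁) (a₁ε₁) β₀ (a₂ε₁)` at every site `x ∈ Δ(p′_y)` of
  every window `y`: THE BACKGROUND-REGULARITY INPUT IN THE PRINTED CURRENCY PER LEVEL ([Balaban1985Variational] Thm 1
  (9) on the cubes of `Ω_j`, one run, its own minimiser; asked here for BOTH runs' backgrounds and the lift, on every
  window box, with the window's level: ESTIMATE, NOT PRINTED in this form; `TermwiseLocalThm1.holderReg_window_family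
  _of_thm1At` feeds it from the tree's typed `B11Thm1.Thm1At` with a PER-LEVEL covering and realisations);
  `hB9F` — the same at run B's fine plaquettes with `lvlBf`;
(const) `ha₀ ha₁ ha₂ hε₁ hε₁1`, the smallness `20480·L²·cReg·ε₁ ≤ 1`, `0 < β₀ ≤ 1` ((9): `β₀ < 1`; `B₄(β₀)`).
OUTPUT: the good clause with `δ⁗_K` explicit — action share `w₀·(dU_K + dL_K)`,
`dU_K = #planes·(cOSC(cOscReg)²ε₁²/4·windowSum (L^{−β₀})² L⁴ (jlogOf Cl K) K + C₂(cReg)·windowSum L⁻² L⁴ (jlogOf Cl K)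
K)`, `dL_K = #planes·C_L(cReg)·windowSum L⁻² L⁴ (jlogOf Cl K) K` — and `Summable δ⁗`.

NOT DELIVERED / THE WALL AFTER THIS FILE: the level maps; `hA9W`/`hB9W`/`hB9F` themselves (⇐ typed Thm 1 per run PER
LEVEL + realisation + covering + the (repr)-identification of `V·` with the runs' minimisers); (repr); (0.31); the
upstream kinds; the W-D island clause (weight half); anything about print.  Value = the term-wise ledger's background
input is now the printed-currency binder per window at the window's level; NOT NE7, NOT summit progress.

References (LOCATIONS only): [Balaban1985Variational] Commun. Math. Phys. 102 (1985) 277–309, conditions (2) p. 278,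
Theorem 1 (7)–(10) p. 279; [Balaban1985BackgroundPropagators] T. Bałaban, Propagators for lattice gauge theories in a
background field, Commun. Math. Phys. 99 (1985) 389–434, (3.39)–(3.40) p. 397; [Balaban1987RG1] Commun. Math. Phys.
109 (1987) 249–301, (0.31) p. 259.
-/

noncomputable section

open Finset MeasureTheory _root_.Filter _root_.Topology
open scoped BigOperators Matrix.Norms.L2Operator

namespace Summit.QuantumFields.BalabanUV.T4Continuum.TermwiseLocal

open Literature.MathematicalPhysics.QuantumFieldTheory.Balaban1983to89
open T4OutputRate T4RecentScale T4GoodClassBudget T4CauchySum T4Crossover T4TowerRateComposition T4TowerRateDischarge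
open T4BoundaryCarrier (BFunctional atFl NE9Fl LipBackgroundFl NE5B)
open T4TermwiseBudget T4TermwiseDeviation T4TermwiseCurrency T4TermwiseBoundary T4TermwiseResidual T4TermwiseAction
open T4TermwiseClassical T4TermwiseQuartic
open T4TermwiseInstantiate (cBCH cBCH_nonneg cSZ cSZ_nonneg)
open T4TermwiseOscillation (cOSC)
open B7Prop1Explicit B7Prop2Explicit B7Prop1Local T4TermwiseBCH T4TermwiseTorus T4TermwiseUN T4TermwiseChainUN
open TermwiseBackground (LocReg cReg cOscReg cReg_nonneg a₀ε₁_le_of_smallness phiM_osc_le_of_locReg)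
open TermwiseHolder (HolderReg binders_of_locRegProfile profile_holder holderRate_window)

/-! ## §8 The pointwise dictionary: `LocReg` at ONE site with the radii of level `j` ⇒ (44) and (44∇) there with the
constants of level `j`; the per-level laws -/

section Pointwise
variable {n : Type*} [Fintype n] [DecidableEq n] [Nonempty n]

/-- **(44) AT ONE PLAQUETTE FROM `LocReg` AT ITS BASE POINT, LEVEL-`j` RADII**: `|V(∂p_x) − 1| ≤ cReg·ε₁·L^{−2j}`
(generation 14's `binders_of_locReg`, second clause, at one site and one level; `2b₁ + 16b₀²` with `b₀ = a₀ε₁L^{−j}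
≤ 1/64`, `ε₁ ≤ 1`). [folklore] -/
theorem plaq_le_of_locReg_level {d : ℕ} {V : B7Prop1Explicit.Site d → Fin d → (Matrix n n ℂ)ˣ}
    {x : B7Prop1Explicit.Site d} (L : ℕ) (hL : 2 ≤ L) {a₀ a₁ b₂ ε₁ : ℝ} (ha₀ : 0 ≤ a₀) (ha₁ : 0 ≤ a₁)
    (hε₁ : 0 ≤ ε₁) (hε₁1 : ε₁ ≤ 1) (hsmall : 20480 * (L : ℝ) ^ 2 * (cReg a₀ a₁ * ε₁) ≤ 1) (j : ℕ)
    (h : LocReg V x 5 (a₀ * ε₁ * ((L : ℝ) ^ j)⁻¹) (a₁ * ε₁ * (((L : ℝ) ^ j)⁻¹) ^ 2) b₂) (κ κ' : Fin d) :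
    ‖((hol V x (plaqWord κ κ') : (Matrix n n ℂ)ˣ) : Matrix n n ℂ) - 1‖ ≤ cReg a₀ a₁ * ε₁ * (((L : ℝ) ^ j)⁻¹) ^ 2 := by
  have hL1 : (1 : ℝ) ≤ L := by exact_mod_cast (le_trans one_le_two hL)
  have hq0 : 0 ≤ ((L : ℝ) ^ j)⁻¹ := by positivity
  have hq1 : ((L : ℝ) ^ j)⁻¹ ≤ 1 := inv_le_one_of_one_le₀ (one_le_pow₀ hL1)
  have hb : a₀ * ε₁ ≤ 1 / 64 := a₀ε₁_le_of_smallness hL ha₀ ha₁ hε₁ hε₁1 hsmall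
  have hb₀ : 0 ≤ a₀ * ε₁ * ((L : ℝ) ^ j)⁻¹ ∧ a₀ * ε₁ * ((L : ℝ) ^ j)⁻¹ ≤ 1 / 64 :=
    ⟨mul_nonneg (mul_nonneg ha₀ hε₁) hq0, (mul_le_of_le_one_right (mul_nonneg ha₀ hε₁) hq1).trans hb⟩
  refine (h.norm_hol_plaq_sub_one_le (by norm_num) hb₀.1 hb₀.2 κ κ').trans ?_
  have hx : 0 ≤ a₀ ^ 2 * (((L : ℝ) ^ j)⁻¹) ^ 2 * (ε₁ - ε₁ ^ 2) :=
    mul_nonneg (by positivity) (by nlinarith)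
  unfold cReg
  nlinarith

/-- **(44∇) AT ONE BOND FROM `LocReg` AT ITS BASE POINT, LEVEL-`j` RADII WITH PROFILE**: with the third radius
`a₂ε₁L^{−2j}·ϑ^j` and `L^{−j} ≤ ϑ^j`, the covariant one-bond oscillation of `log V(∂p)` at `z` is
`≤ (4a₂ + 100a₀a₁ + 132a₀³)·ε₁·L^{−2j}·ϑ^j` (generation 15's `binders_of_locRegProfile`, third clause, at one site and
one level). [folklore] -/
theorem osc_le_of_locReg_level {d : ℕ} {V : B7Prop1Explicit.Site d → Fin d → (Matrix n n ℂ)ˣ}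
    {z : B7Prop1Explicit.Site d} (L : ℕ) (hL : 2 ≤ L) {a₀ a₁ a₂ ε₁ ϑ : ℝ} (ha₀ : 0 ≤ a₀) (ha₁ : 0 ≤ a₁)
    (hε₁ : 0 ≤ ε₁) (hε₁1 : ε₁ ≤ 1) (hsmall : 20480 * (L : ℝ) ^ 2 * (cReg a₀ a₁ * ε₁) ≤ 1) (j : ℕ)
    (hϑj : ((L : ℝ) ^ j)⁻¹ ≤ ϑ ^ j)
    (h : LocReg V z 5 (a₀ * ε₁ * ((L : ℝ) ^ j)⁻¹) (a₁ * ε₁ * (((L : ℝ) ^ j)⁻¹) ^ 2)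
      (a₂ * ε₁ * (((L : ℝ) ^ j)⁻¹) ^ 2 * ϑ ^ j)) (P : Fin d × Fin d) (κ : Fin d) :
    ‖((V z κ : (Matrix n n ℂ)ˣ) : Matrix n n ℂ) * phiM V P (z + e κ) * (((V z κ)⁻¹ : (Matrix n n ℂ)ˣ) : Matrix n n ℂ)
        - phiM V P z‖ ≤ (4 * a₂ + 100 * a₀ * a₁ + 132 * a₀ ^ 3) * ε₁ * (((L : ℝ) ^ j)⁻¹) ^ 2 * ϑ ^ j := by
  have hL1 : (1 : ℝ) ≤ L := by exact_mod_cast (le_trans one_le_two hL)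
  have hq0 : 0 ≤ ((L : ℝ) ^ j)⁻¹ := by positivity
  have hq1 : ((L : ℝ) ^ j)⁻¹ ≤ 1 := inv_le_one_of_one_le₀ (one_le_pow₀ hL1)
  have hb : a₀ * ε₁ ≤ 1 / 64 := a₀ε₁_le_of_smallness hL ha₀ ha₁ hε₁ hε₁1 hsmall
  have hb₀ : 0 ≤ a₀ * ε₁ * ((L : ℝ) ^ j)⁻¹ ∧ a₀ * ε₁ * ((L : ℝ) ^ j)⁻¹ ≤ 1 / 64 :=
    ⟨mul_nonneg (mul_nonneg ha₀ hε₁) hq0, (mul_le_of_le_one_right (mul_nonneg ha₀ hε₁) hq1).trans hb⟩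
  have hb₁ : 0 ≤ a₁ * ε₁ * (((L : ℝ) ^ j)⁻¹) ^ 2 := by positivity
  refine (phiM_osc_le_of_locReg h le_rfl hb₀.1 hb₀.2 hb₁ P κ).trans ?_
  have he2 : ε₁ ^ 2 ≤ ε₁ := by nlinarith
  have he3 : ε₁ ^ 3 ≤ ε₁ := by nlinarith
  have he2q : ε₁ ^ 2 * ((L : ℝ) ^ j)⁻¹ ≤ ε₁ * ϑ ^ j := mul_le_mul he2 hϑj hq0 hε₁
  have he3q : ε₁ ^ 3 * ((L : ℝ) ^ j)⁻¹ ≤ ε₁ * ϑ ^ j := mul_le_mul he3 hϑj hq0 hε₁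
  have hx₁ : 0 ≤ a₀ * a₁ * (((L : ℝ) ^ j)⁻¹) ^ 2 * (ε₁ * ϑ ^ j - ε₁ ^ 2 * ((L : ℝ) ^ j)⁻¹) :=
    mul_nonneg (by positivity) (by linarith)
  have hx₂ : 0 ≤ a₀ ^ 3 * (((L : ℝ) ^ j)⁻¹) ^ 2 * (ε₁ * ϑ ^ j - ε₁ ^ 3 * ((L : ℝ) ^ j)⁻¹) :=
    mul_nonneg (by positivity) (by linarith)
  nlinarith

/-- **THE PER-LEVEL LAWS** of the two constant families `α_j = cReg·ε₁·L^{−2j}` and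
`α₁,j = (4a₂ + 100a₀a₁ + 132a₀³)·ε₁·L^{−2j}·h_j`: the smallness `20480·L²·α_j ≤ 1` at every level (from the one at
`j = 0`) and the (44∇) law with `c_{α1} = cOscReg` (an identity of powers of `L`) — the arithmetic of generation 15's
`binders_of_locRegProfile`, read off at a vacuous term class. [folklore] -/
theorem laws_of_locRegProfile (L : ℕ) (hL : 2 ≤ L) {a₀ a₁ a₂ ε₁ : ℝ} {h : ℕ → ℝ} (ha₀ : 0 ≤ a₀) (ha₁ : 0 ≤ a₁)
    (ha₂ : 0 ≤ a₂) (hε₁ : 0 ≤ ε₁) (hε₁1 : ε₁ ≤ 1) (hsmall : 20480 * (L : ℝ) ^ 2 * (cReg a₀ a₁ * ε₁) ≤ 1)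
    (hh : ∀ j, ((L : ℝ) ^ j)⁻¹ ≤ h j) :
    (∀ j, 0 ≤ cReg a₀ a₁ * ε₁ * (((L : ℝ) ^ j)⁻¹) ^ 2 ∧
      20480 * (L : ℝ) ^ 2 * (cReg a₀ a₁ * ε₁ * (((L : ℝ) ^ j)⁻¹) ^ 2) ≤ 1) ∧
    (∀ j, 0 ≤ (4 * a₂ + 100 * a₀ * a₁ + 132 * a₀ ^ 3) * ε₁ * (((L : ℝ) ^ j)⁻¹) ^ 2 * h j ∧
      (4 * a₂ + 100 * a₀ * a₁ + 132 * a₀ ^ 3) * ε₁ * (((L : ℝ) ^ j)⁻¹) ^ 2 * h j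
        ≤ cOscReg L a₀ a₁ a₂ * ε₁ * (((L : ℝ) ^ (j + 1))⁻¹) ^ 2 * h j) := by
  obtain ⟨h1, -, -, h4⟩ := binders_of_locRegProfile (n := Fin 1) (ι := Unit) (σ := Unit) (l₀ := 0)
    (T := fun _ => (∅ : Finset Unit)) (Bad := fun _ _ => ∅) (Adm := Set.univ) L hL
    (fun _ _ _ _ => fun (_ : B7Prop1Explicit.Site 4) (_ : Fin 4) => (1 : (Matrix (Fin 1) (Fin 1) ℂ)ˣ))
    ha₀ ha₁ ha₂ hε₁ hε₁1 hsmall hh (fun K t _ τ hτ => absurd hτ (by simp))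
  exact ⟨h1, h4⟩

end Pointwise

/-! ## §9 The U(N) ledger theorem with the background binder in the PRINTED HÖLDER CURRENCY, PER WINDOW AT THE WINDOW's
LEVEL -/

section Ledger
variable {n : Type*} [Fintype n] [DecidableEq n] [Nonempty n]
variable {C : T4BoundaryCarrier.Carriers} {ι : Type} [MeasurableSpace ι] {σ : Type*} [DecidableEq σ] {l₀ vol : ℝ}
  {T : ℕ → Finset σ} {Bad : ℕ → ℝ → Finset σ} {A B : ℕ → ℝ → σ → ℝ} {μ : ℕ → ℝ → σ → Measure ι}
  {fac bfac rfac : ℕ → ℝ → σ → Finset C.Dom} {Adm : Set ι} {EA : Functional C.toCarriers C.BgA}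
  {EB : Functional C.toCarriers C.BgB} {BA : BFunctional C C.BgA} {BB : BFunctional C C.BgB}
  {RA : Functional C.toCarriers C.BgA} {RB : Functional C.toCarriers C.BgB}
  {κ θ' Cr EB₀ CrR R₁ b β' w₀ : ℝ} {κ₀ : ℕ} {gA gB : ℕ → ℕ → ℝ} {gfA gfB : ℕ → ℝ} {gsA gsB : ℕ → ℕ → ℝ}
  {uA : ℕ → ι → C.BgA} {uB : ℕ → ι → C.BgB} {oneA : C.BgA} {oneB : C.BgB}
  {pend : ℕ → ℝ → σ → ι → C.Fl} {nA nB aA aB wA wB γA γB : ℕ → ℝ → σ → ι → ℝ} {qA qB : ℕ → ℝ}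
  {κ₁ S : ℕ → ℝ → σ → ℕ → ℝ} {cW RW : ℕ → ℝ → σ → ℝ} {rw sw rγ zA zB c₀ : ℕ → ℝ} {Cw E a Λ Cl : ℝ}

/-- **THE GOOD-CLASS HALF WITH `Summable δ⁗` FOR G = U(N) WILSON TERMS, THE BACKGROUND BINDER IN THE PRINTED HÖLDER
CURRENCY PER WINDOW AT THE WINDOW's LEVEL.**  `TermwiseLocal.goodClause_summable_UN_levels` with its per-window
inputs (44-loc) `hA hB hBf`, (44∇-loc) `hAosc` and the per-level laws `hαlev hdecay hα₁lev` DISCHARGED from ONE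
regularity binder per window: `HolderReg (V· K t τ v) x 6 (L^{lvl y})⁻¹ (a₀ε₁) (a₁ε₁) β₀ (a₂ε₁)` at every site `x` of
the window box `Δ(p′_y)` (`hA9W`/`hB9W`; and `hB9F` at run B's fine plaquettes with `lvlBf`) — generation 16's
`HolderReg` (B11 Theorem 1 (9) read with B9 (3.40) at `U₀ = 1`, the tree's `HolderOn` by name) AT SPACING
`(L^{lvl y})⁻¹` INSTEAD OF `(L^K)⁻¹`: the level-`j` regularity of [Balaban1985Variational] conditions (2)/(9) on the
domain `Ω_j` — via `HolderReg.locReg_level` (per site), §8's pointwise dictionary, `profile_holder` (`ϑ = L^{−β₀}`,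
`0 < β₀ ≤ 1`) and `interpolation_averaging_UN_levels_profile`.  Every other binder BY NAME and VERBATIM (the flow
window (0.31) in `h031A`/`h031B`, (repr), `hMvol`, the window clauses `hwinA hwinB hwinBf`, the upstream kinds).
OUTPUT: the good clause with `δ⁗` whose action share is `w₀·(#planes·(cOSC(cOscReg)²ε₁²/4·windowSum (L^{−β₀})² L⁴
(jlogOf Cl K) K + C₂(cReg)·windowSum L⁻² L⁴ (jlogOf Cl K) K) + #planes·C_L(cReg)·windowSum L⁻² L⁴ (jlogOf Cl K) K)`
and `Summable δ⁗`.  No print is quoted as a fact; nothing printed is asserted; NOT NE7, NOT Clay. [folklore] -/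
theorem goodClause_summable_UN_levels_of_holderReg {Y YA : Type*} {Sfib : ℕ → ℝ → σ → ι → Set Y}
    {SfibA : ℕ → ℝ → σ → ι → Set YA} {g : ℕ → ℝ → σ → ι → YA → ℝ} {f₁ : ℕ → ℝ → σ → ι → Y → ℝ}
    {Q : ℕ → ℝ → σ → ι → Y → YA} {yA yB : ℕ → ℝ → σ → ι → Y} {xA : ℕ → ℝ → σ → ι → YA}
    (M L : ℕ) (hMtwo : 2 ≤ M) (hLtwo : 2 ≤ L) (planes : Finset (Fin 4 × Fin 4))
    (hplanes : ∀ P ∈ planes, P.1 ≠ P.2)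
    (VA VB : ℕ → ℝ → σ → ι → (B7Prop1Explicit.Site 4 → Fin 4 → (Matrix n n ℂ)ˣ))
    (lvlA lvlB lvlBf : ℕ → ℝ → σ → ι → (Fin 4 × Fin 4) × B7Prop1Explicit.Site 4 → ℕ)
    {a₀ a₁ a₂ ε₁ β₀ : ℝ}
    (hUR : ∀ K, URateUpTo K EA EB (gA K) (gB K) (uA K) (uB K) Adm Cr θ' κ) (hCr : 0 ≤ Cr)
    (hθ'0 : 0 < θ') (hθ'1 : θ' < 1) (hθ'Λ : θ' ≤ Λ) (hΛ1 : 1 ≤ Λ) (hCl : 0 ≤ Cl)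
    (hURB : ∀ b ∈ C.admFl, ∀ K, URateUpTo K (atFl BA b) (atFl BB b) (gA K) (gB K) (uA K) (uB K) Adm EB₀ θ' κ)
    (hEB₀ : 0 ≤ EB₀)
    (hURR : ∀ K, URateUpTo K RA RB (gA K) (gB K) (uA K) (uB K) Adm CrR θ' κ) (hCrR : 0 ≤ CrR)
    (hfmtA : ∀ K t τ, A K t τ = ∫ v, (∏ X ∈ fac K t τ,
      Real.exp (EA (gA K) (uA K v) X - EA (gA K) oneA X)) *
        ((∏ X ∈ bfac K t τ, Real.exp (BA (gA K) (uA K v) (pend K t τ v) X)) * nA K t τ v * qA K *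
          ((∏ X ∈ rfac K t τ, Real.exp (RA (gA K) (uA K v) X - RA (gA K) oneA X)) * (Real.exp (-aA K t τ v) * wA K t τ v)))
          ∂(μ K t τ))
    (hfmtB : ∀ K t τ, B K t τ = ∫ v, (∏ X ∈ fac K t τ,
      Real.exp (EB (gB K) (uB K v) X - EB (gB K) oneB X)) *
        ((∏ X ∈ bfac K t τ, Real.exp (BB (gB K) (uB K v) (pend K t τ v) X)) * nB K t τ v * qB K *
          ((∏ X ∈ rfac K t τ, Real.exp (RB (gB K) (uB K v) X - RB (gB K) oneB X)) * (Real.exp (-aB K t τ v) * wB K t τ v)))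
          ∂(μ K t τ))
    (hint : ∀ K t, |t| ≤ l₀ → ∀ τ ∈ T K \ Bad K t,
      Integrable (fun v => (∏ X ∈ fac K t τ, Real.exp (EA (gA K) (uA K v) X - EA (gA K) oneA X)) *
        ((∏ X ∈ bfac K t τ, Real.exp (BA (gA K) (uA K v) (pend K t τ v) X)) * nA K t τ v * qA K *
          ((∏ X ∈ rfac K t τ, Real.exp (RA (gA K) (uA K v) X - RA (gA K) oneA X)) * (Real.exp (-aA K t τ v) * wA K t τ v))))
          (μ K t τ) ∧
      Integrable (fun v => (∏ X ∈ fac K t τ, Real.exp (EB (gB K) (uB K v) X - EB (gB K) oneB X)) *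
        ((∏ X ∈ bfac K t τ, Real.exp (BB (gB K) (uB K v) (pend K t τ v) X)) * nB K t τ v * qB K *
          ((∏ X ∈ rfac K t τ, Real.exp (RB (gB K) (uB K v) X - RB (gB K) oneB X)) * (Real.exp (-aB K t τ v) * wB K t τ v))))
          (μ K t τ))
    (hsc : ∀ K t, |t| ≤ l₀ → ∀ τ ∈ T K \ Bad K t, ∀ X ∈ fac K t τ, C.scale X ≤ K)
    (hoff : ∀ K t, |t| ≤ l₀ → ∀ τ ∈ T K \ Bad K t, ∀ v, v ∉ Adm →
      (∏ X ∈ fac K t τ, Real.exp (EA (gA K) (uA K v) X - EA (gA K) oneA X)) *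
        ((∏ X ∈ bfac K t τ, Real.exp (BA (gA K) (uA K v) (pend K t τ v) X)) * nA K t τ v * qA K *
          ((∏ X ∈ rfac K t τ, Real.exp (RA (gA K) (uA K v) X - RA (gA K) oneA X)) * (Real.exp (-aA K t τ v) * wA K t τ v)))
          = 0 ∧
      (∏ X ∈ fac K t τ, Real.exp (EB (gB K) (uB K v) X - EB (gB K) oneB X)) *
        ((∏ X ∈ bfac K t τ, Real.exp (BB (gB K) (uB K v) (pend K t τ v) X)) * nB K t τ v * qB K *
          ((∏ X ∈ rfac K t τ, Real.exp (RB (gB K) (uB K v) X - RB (gB K) oneB X)) * (Real.exp (-aB K t τ v) * wB K t τ v)))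
          = 0)
    (hS : ∀ K t, |t| ≤ l₀ → ∀ τ ∈ T K \ Bad K t, ∀ v ∈ Adm, ∀ j ≤ K,
      |(∑ X ∈ fac K t τ with C.scale X = j,
          (Real.log (Real.exp (EB (gB K) (uB K v) X - EB (gB K) oneB X))
            - Real.log (Real.exp (EA (gA K) (uA K v) X - EA (gA K) oneA X)))) - κ₁ K t τ j| ≤ S K t τ j)
    (hM : ∀ K t, |t| ≤ l₀ → ∀ τ ∈ T K \ Bad K t,
      Multiplicity (fac K t τ) C.scale (fun X => Real.exp (-(κ * C.d X))) Cw vol Λ K)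
    (hwit : ∀ K, ∃ v₁ ∈ Adm, uA K v₁ = oneA ∧ uB K v₁ = oneB)
    (hvol : 0 ≤ vol) (hE : 0 ≤ E) (ha0 : 0 < a) (ha1 : a < 1)
    (hSle : ∀ K t, |t| ≤ l₀ → ∀ τ ∈ T K \ Bad K t, ∀ j ≤ K, S K t τ j ≤ vol * (E * a ^ (K - j)))
    (hpend : ∀ K t, |t| ≤ l₀ → ∀ τ ∈ T K \ Bad K t, ∀ v ∈ Adm, pend K t τ v ∈ C.admFl)
    (hBwin : ∀ K t, |t| ≤ l₀ → ∀ τ ∈ T K \ Bad K t, RecentOnly (bfac K t τ) C.scale (jlogOf Cl K) K)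
    (hMB : ∀ K t, |t| ≤ l₀ → ∀ τ ∈ T K \ Bad K t,
      Multiplicity (bfac K t τ) C.scale (fun X => Real.exp (-(κ * C.d X))) Cw vol Λ K)
    (hnpos : ∀ K t, |t| ≤ l₀ → ∀ τ ∈ T K \ Bad K t, ∀ v ∈ Adm, 0 < nA K t τ v ∧ 0 < nB K t τ v)
    (hzA : ∀ K t, |t| ≤ l₀ → ∀ τ ∈ T K \ Bad K t, ∀ v ∈ Adm, |Real.log (nA K t τ v)| ≤ vol * zA K)
    (hzB : ∀ K t, |t| ≤ l₀ → ∀ τ ∈ T K \ Bad K t, ∀ v ∈ Adm, |Real.log (nB K t τ v)| ≤ vol * zB K)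
    (hzAs : Summable zA) (hzBs : Summable zB)
    (hq : ∀ K, 0 < qA K ∧ 0 < qB K)
    -- the 𝐑-kind: scales, multiplicity, one-run slice sizes, the flow window of both coupling tables
    (hrsc : ∀ K t, |t| ≤ l₀ → ∀ τ ∈ T K \ Bad K t, ∀ X ∈ rfac K t τ, C.scale X ≤ K)
    (hMR : ∀ K t, |t| ≤ l₀ → ∀ τ ∈ T K \ Bad K t,
      Multiplicity (rfac K t τ) C.scale (fun X => Real.exp (-(κ * C.d X))) Cw vol Λ K)
    (hRSA : ∀ K t, |t| ≤ l₀ → ∀ τ ∈ T K \ Bad K t, ∀ v ∈ Adm, ∀ j ≤ K,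
      |∑ X ∈ rfac K t τ with C.scale X = j, (RA (gA K) (uA K v) X - RA (gA K) oneA X)| ≤ vol * (R₁ * gsA K j ^ κ₀))
    (hRSB : ∀ K t, |t| ≤ l₀ → ∀ τ ∈ T K \ Bad K t, ∀ v ∈ Adm, ∀ j ≤ K,
      |∑ X ∈ rfac K t τ with C.scale X = j, (RB (gB K) (uB K v) X - RB (gB K) oneB X)| ≤ vol * (R₁ * gsB K j ^ κ₀))
    (hb : 0 < b) (h031A : ∀ K, Step.Discrete031 b β' K (gfA K) (gsA K))
    (h031B : ∀ K, Step.Discrete031 b β' K (gfB K) (gsB K)) (hgsA : ∀ K k, k ≤ K → 0 ≤ gsA K k)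
    (hgsB : ∀ K k, k ≤ K → 0 ≤ gsB K k) (hR₁ : 0 ≤ R₁) (hκ₀ : 4 < κ₀)
    -- the ACTION kind from ONE CLASSICAL STEP: (min-A) (Q) (lift) (min-B) (act) (U) (L) (γ)
    (hminA : ∀ K t, |t| ≤ l₀ → ∀ τ ∈ T K \ Bad K t, ∀ v ∈ Adm, IsMinOn (g K t τ v) (SfibA K t τ v) (xA K t τ v))
    (hQ : ∀ K t, |t| ≤ l₀ → ∀ τ ∈ T K \ Bad K t, ∀ v ∈ Adm, Set.MapsTo (Q K t τ v) (Sfib K t τ v) (SfibA K t τ v))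
    (hlift : ∀ K t, |t| ≤ l₀ → ∀ τ ∈ T K \ Bad K t, ∀ v ∈ Adm,
      yA K t τ v ∈ Sfib K t τ v ∧ Q K t τ v (yA K t τ v) = xA K t τ v)
    (hminB : ∀ K t, |t| ≤ l₀ → ∀ τ ∈ T K \ Bad K t, ∀ v ∈ Adm,
      yB K t τ v ∈ Sfib K t τ v ∧ IsMinOn (f₁ K t τ v) (Sfib K t τ v) (yB K t τ v))
    (hact : ∀ K t, |t| ≤ l₀ → ∀ τ ∈ T K \ Bad K t, ∀ v ∈ Adm,
      aA K t τ v = w₀ * g K t τ v (xA K t τ v) + γA K t τ v ∧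
        aB K t τ v = w₀ * f₁ K t τ v (yB K t τ v) + γB K t τ v)
    (hw₀ : 0 ≤ w₀)
    -- (U)(L) PRODUCED for G = U(N) Wilson terms from the PRINTED-CURRENCY regularity binder PER WINDOW AT THE WINDOW's
    -- LEVEL (`HolderReg` = B11 Thm 1 (9) read with B9 (3.40) at U₀ = 1, spacing (L^{lvl y})⁻¹, Hölder exponent β₀):
    -- unitarity + periodicity `hAU hBU`, `hA9W hB9W` on the window boxes, `hB9F` at run B's fine plaquettes, the
    -- window clauses `hwinA hwinB hwinBf`, the constants' signs, `ε₁ ≤ 1`, the smallness, `0 < β₀ ≤ 1`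
    (hAU : ∀ K t, |t| ≤ l₀ → ∀ τ ∈ T K \ Bad K t, ∀ v ∈ Adm,
      (∀ x κ, VA K t τ v x κ ∈ unitaryUnits (Matrix n n ℂ)) ∧ IsPeriodic (M * L ^ K * L) (VA K t τ v))
    (hBU : ∀ K t, |t| ≤ l₀ → ∀ τ ∈ T K \ Bad K t, ∀ v ∈ Adm,
      (∀ x κ, VB K t τ v x κ ∈ unitaryUnits (Matrix n n ℂ)) ∧ IsPeriodic (M * L ^ K * L) (VB K t τ v))
    (hA9W : ∀ K t, |t| ≤ l₀ → ∀ τ ∈ T K \ Bad K t, ∀ v ∈ Adm, ∀ y ∈ pbox planes (M * L ^ K),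
      ∀ x : B7Prop1Explicit.Site 4, InBox ((L : ℤ) • y.2) (deltaHi L ((L : ℤ) • y.2) y.1.1 y.1.2) x →
        HolderReg (VA K t τ v) x 6 (((L : ℝ) ^ lvlA K t τ v y)⁻¹) (a₀ * ε₁) (a₁ * ε₁) β₀ (a₂ * ε₁))
    (hB9W : ∀ K t, |t| ≤ l₀ → ∀ τ ∈ T K \ Bad K t, ∀ v ∈ Adm, ∀ y ∈ pbox planes (M * L ^ K),
      ∀ x : B7Prop1Explicit.Site 4, InBox ((L : ℤ) • y.2) (deltaHi L ((L : ℤ) • y.2) y.1.1 y.1.2) x →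
        HolderReg (VB K t τ v) x 6 (((L : ℝ) ^ lvlB K t τ v y)⁻¹) (a₀ * ε₁) (a₁ * ε₁) β₀ (a₂ * ε₁))
    (hB9F : ∀ K t, |t| ≤ l₀ → ∀ τ ∈ T K \ Bad K t, ∀ v ∈ Adm, ∀ x ∈ pbox planes (M * L ^ K * L),
      HolderReg (VB K t τ v) x.2 6 (((L : ℝ) ^ lvlBf K t τ v x)⁻¹) (a₀ * ε₁) (a₁ * ε₁) β₀ (a₂ * ε₁))
    (hwinA : ∀ K t, |t| ≤ l₀ → ∀ τ ∈ T K \ Bad K t, ∀ v ∈ Adm,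
      RecentOnly (pbox planes (M * L ^ K)) (lvlA K t τ v) (jlogOf Cl K) K)
    (hwinB : ∀ K t, |t| ≤ l₀ → ∀ τ ∈ T K \ Bad K t, ∀ v ∈ Adm,
      RecentOnly (pbox planes (M * L ^ K)) (lvlB K t τ v) (jlogOf Cl K) K)
    (hwinBf : ∀ K t, |t| ≤ l₀ → ∀ τ ∈ T K \ Bad K t, ∀ v ∈ Adm,
      RecentOnly (pbox planes (M * L ^ K * L)) (lvlBf K t τ v) (jlogOf Cl K) K)
    (ha₀ : 0 ≤ a₀) (ha₁ : 0 ≤ a₁) (ha₂ : 0 ≤ a₂) (hε₁ : 0 ≤ ε₁) (hε₁1 : ε₁ ≤ 1)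
    (hsmall : 20480 * (L : ℝ) ^ 2 * (cReg a₀ a₁ * ε₁) ≤ 1) (hβ₀ : 0 < β₀) (hβ₀1 : β₀ ≤ 1)
    (hreprU : ∀ K t, |t| ≤ l₀ → ∀ τ ∈ T K \ Bad K t, ∀ v ∈ Adm,
      f₁ K t τ v (yA K t τ v) = ∑ x ∈ pbox planes (M * L ^ K * L), eN (phiU (VA K t τ v) x) ∧
        g K t τ v (xA K t τ v) = ∑ y ∈ pbox planes (M * L ^ K), eN (psiU L (VA K t τ v) y))
    (hreprL : ∀ K t, |t| ≤ l₀ → ∀ τ ∈ T K \ Bad K t, ∀ v ∈ Adm,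
      f₁ K t τ v (yB K t τ v) = ∑ x ∈ pbox planes (M * L ^ K * L), eN (phiU (VB K t τ v) x) ∧
        g K t τ v (Q K t τ v (yB K t τ v)) = ∑ y ∈ pbox planes (M * L ^ K), eN (psiU L (VB K t τ v) y))
    (hMvol : ((M : ℝ)) ^ 4 ≤ vol)
    (hγ : ∀ K t, |t| ≤ l₀ → ∀ τ ∈ T K \ Bad K t, ∀ v ∈ Adm, |γB K t τ v - γA K t τ v| ≤ vol * rγ K)
    (hrγ : Summable rγ)
    -- the residual kind after generation 8: (R-w) radii about a centre `cW`, (W-w) the WITNESS log-ratio centred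
    (hwpos : ∀ K t, |t| ≤ l₀ → ∀ τ ∈ T K \ Bad K t, ∀ v ∈ Adm, 0 < wA K t τ v ∧ 0 < wB K t τ v)
    (hRw : ∀ K t, |t| ≤ l₀ → ∀ τ ∈ T K \ Bad K t, ∀ v ∈ Adm,
      |Real.log (wB K t τ v) - Real.log (wA K t τ v) - cW K t τ| ≤ RW K t τ)
    (hRRw : ∀ K t, |t| ≤ l₀ → ∀ τ ∈ T K \ Bad K t, RW K t τ ≤ vol * rw K) (hrw : Summable rw)
    (hWw : ∀ K t, |t| ≤ l₀ → ∀ τ ∈ T K \ Bad K t, ∀ v ∈ Adm, uA K v = oneA → uB K v = oneB →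
      |Real.log (wB K t τ v) - Real.log (wA K t τ v) - c₀ K| ≤ vol * sw K)
    (hsw : Summable sw) :
    GoodClause l₀ vol T A B Bad
        (fun K => (max Cw 1 * ((E + Cr) * ∑ x ∈ antidiagonal K, min (a ^ x.2) (θ' ^ x.1 * Λ ^ x.2))
            + (EB₀ * Cw * windowSum θ' Λ (jlogOf Cl K) K + (zA K + zB K)
              + (max (2 * Cw) 1 * ((∑ p ∈ antidiagonal K, min (R₁ * gsA K p.1 ^ κ₀) (CrR * θ' ^ p.1 * Λ ^ p.2))
                  + ∑ p ∈ antidiagonal K, min (R₁ * gsB K p.1 ^ κ₀) (CrR * θ' ^ p.1 * Λ ^ p.2))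
                + (w₀ * ((planes.card : ℝ) * (cOSC L (cOscReg L a₀ a₁ a₂) ^ 2 * ε₁ ^ 2 / 4
                        * windowSum (((L : ℝ) ^ (-β₀)) ^ 2) ((L : ℝ) ^ 4) (jlogOf Cl K) K
                      + (cSZ L (cReg a₀ a₁) * cBCH L (cReg a₀ a₁) * ε₁ ^ 3 + (Fintype.card n : ℝ) / 24
                          * (cSZ L (cReg a₀ a₁) * ε₁ + cBCH L (cReg a₀ a₁) * ε₁ ^ 2) ^ 4)
                        * windowSum (((L : ℝ) ^ 2)⁻¹) ((L : ℝ) ^ 4) (jlogOf Cl K) K)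
                    + (planes.card : ℝ) * (cSZ L (cReg a₀ a₁) * cBCH L (cReg a₀ a₁) * ε₁ ^ 3
                        + cBCH L (cReg a₀ a₁) ^ 2 * ε₁ ^ 4 / 2
                        + (Fintype.card n : ℝ) / 24 * (cSZ L (cReg a₀ a₁) ^ 4 * ε₁ ^ 4))
                      * windowSum (((L : ℝ) ^ 2)⁻¹) ((L : ℝ) ^ 4) (jlogOf Cl K) K)
                  + rγ K + rw K))))
          + (max Cw 1 * ((E + Cr) * ∑ x ∈ antidiagonal K, min (a ^ x.2) (θ' ^ x.1 * Λ ^ x.2)) + (rw K + sw K))) ∧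
      Summable (fun K => (max Cw 1 * ((E + Cr) * ∑ x ∈ antidiagonal K, min (a ^ x.2) (θ' ^ x.1 * Λ ^ x.2))
            + (EB₀ * Cw * windowSum θ' Λ (jlogOf Cl K) K + (zA K + zB K)
              + (max (2 * Cw) 1 * ((∑ p ∈ antidiagonal K, min (R₁ * gsA K p.1 ^ κ₀) (CrR * θ' ^ p.1 * Λ ^ p.2))
                  + ∑ p ∈ antidiagonal K, min (R₁ * gsB K p.1 ^ κ₀) (CrR * θ' ^ p.1 * Λ ^ p.2))
                + (w₀ * ((planes.card : ℝ) * (cOSC L (cOscReg L a₀ a₁ a₂) ^ 2 * ε₁ ^ 2 / 4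
                        * windowSum (((L : ℝ) ^ (-β₀)) ^ 2) ((L : ℝ) ^ 4) (jlogOf Cl K) K
                      + (cSZ L (cReg a₀ a₁) * cBCH L (cReg a₀ a₁) * ε₁ ^ 3 + (Fintype.card n : ℝ) / 24
                          * (cSZ L (cReg a₀ a₁) * ε₁ + cBCH L (cReg a₀ a₁) * ε₁ ^ 2) ^ 4)
                        * windowSum (((L : ℝ) ^ 2)⁻¹) ((L : ℝ) ^ 4) (jlogOf Cl K) K)
                    + (planes.card : ℝ) * (cSZ L (cReg a₀ a₁) * cBCH L (cReg a₀ a₁) * ε₁ ^ 3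
                        + cBCH L (cReg a₀ a₁) ^ 2 * ε₁ ^ 4 / 2
                        + (Fintype.card n : ℝ) / 24 * (cSZ L (cReg a₀ a₁) ^ 4 * ε₁ ^ 4))
                      * windowSum (((L : ℝ) ^ 2)⁻¹) ((L : ℝ) ^ 4) (jlogOf Cl K) K)
                  + rγ K + rw K))))
          + (max Cw 1 * ((E + Cr) * ∑ x ∈ antidiagonal K, min (a ^ x.2) (θ' ^ x.1 * Λ ^ x.2)) + (rw K + sw K))) := by
  have hL1 : 1 ≤ L := by omega
  have hLr : (1 : ℝ) < L := by exact_mod_cast (lt_of_lt_of_le one_lt_two hLtwo)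
  have hL0r : (0 : ℝ) < L := by linarith
  obtain ⟨hprof, -⟩ := profile_holder hLtwo hβ₀ hβ₀1
  obtain ⟨-, hϑ1⟩ := holderRate_window hLr hβ₀ hβ₀1
  have hϑ0 : (0 : ℝ) < (L : ℝ) ^ (-β₀) := Real.rpow_pos_of_pos hL0r _
  obtain ⟨hαlev, hα₁lev⟩ := laws_of_locRegProfile L hLtwo ha₀ ha₁ ha₂ hε₁ hε₁1 hsmall (fun j => (hprof j).1)
  -- the per-window inputs (44-loc), (44∇-loc) from `HolderReg` per window via `LocReg` per window
  have hdictA : ∀ K t, |t| ≤ l₀ → ∀ τ ∈ T K \ Bad K t, ∀ v ∈ Adm, ∀ y ∈ pbox planes (M * L ^ K),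
      ∀ x : B7Prop1Explicit.Site 4, InBox ((L : ℤ) • y.2) (deltaHi L ((L : ℤ) • y.2) y.1.1 y.1.2) x →
        LocReg (VA K t τ v) x 5 (a₀ * ε₁ * ((L : ℝ) ^ lvlA K t τ v y)⁻¹)
          (a₁ * ε₁ * (((L : ℝ) ^ lvlA K t τ v y)⁻¹) ^ 2)
          (a₂ * ε₁ * (((L : ℝ) ^ lvlA K t τ v y)⁻¹) ^ 2 * ((L : ℝ) ^ (-β₀)) ^ lvlA K t τ v y) :=
    fun K t ht τ hτ v hv y hy x hx => (hA9W K t ht τ hτ v hv y hy x hx).locReg_level hL1 _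
  have hdictB : ∀ K t, |t| ≤ l₀ → ∀ τ ∈ T K \ Bad K t, ∀ v ∈ Adm, ∀ y ∈ pbox planes (M * L ^ K),
      ∀ x : B7Prop1Explicit.Site 4, InBox ((L : ℤ) • y.2) (deltaHi L ((L : ℤ) • y.2) y.1.1 y.1.2) x →
        LocReg (VB K t τ v) x 5 (a₀ * ε₁ * ((L : ℝ) ^ lvlB K t τ v y)⁻¹)
          (a₁ * ε₁ * (((L : ℝ) ^ lvlB K t τ v y)⁻¹) ^ 2)
          (a₂ * ε₁ * (((L : ℝ) ^ lvlB K t τ v y)⁻¹) ^ 2 * ((L : ℝ) ^ (-β₀)) ^ lvlB K t τ v y) :=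
    fun K t ht τ hτ v hv y hy x hx => (hB9W K t ht τ hτ v hv y hy x hx).locReg_level hL1 _
  obtain ⟨hU, hLd, hU0, hL0, hUs, hLs⟩ := interpolation_averaging_UN_levels_profile (l₀ := l₀) (T := T)
    (Bad := Bad) (Adm := Adm) (g := g) (f₁ := f₁) (Q := Q) (yA := yA) (yB := yB) (xA := xA) M L hMtwo hLtwo planes
    hplanes VA VB lvlA lvlB lvlBf
    (αlev := fun j => cReg a₀ a₁ * ε₁ * (((L : ℝ) ^ j)⁻¹) ^ 2)
    (α₁lev := fun j => (4 * a₂ + 100 * a₀ * a₁ + 132 * a₀ ^ 3) * ε₁ * (((L : ℝ) ^ j)⁻¹) ^ 2 * ((L : ℝ) ^ (-β₀)) ^ j)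
    (cα := cReg a₀ a₁) (cα₁ := cOscReg L a₀ a₁ a₂) (ϑ := (L : ℝ) ^ (-β₀)) hαlev
    (fun K t ht τ hτ v hv => ⟨(hAU K t ht τ hτ v hv).1, (hAU K t ht τ hτ v hv).2, fun y hy x κ κ' _ hp =>
      plaq_le_of_locReg_level L hLtwo ha₀ ha₁ hε₁ hε₁1 hsmall _ (hdictA K t ht τ hτ v hv y hy x hp.1) κ κ'⟩)
    (fun K t ht τ hτ v hv => ⟨(hBU K t ht τ hτ v hv).1, (hBU K t ht τ hτ v hv).2, fun y hy x κ κ' _ hp =>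
      plaq_le_of_locReg_level L hLtwo ha₀ ha₁ hε₁ hε₁1 hsmall _ (hdictB K t ht τ hτ v hv y hy x hp.1) κ κ'⟩)
    (fun K t ht τ hτ v hv x hx =>
      plaq_le_of_locReg_level L hLtwo ha₀ ha₁ hε₁ hε₁1 hsmall _ ((hB9F K t ht τ hτ v hv x hx).locReg_level hL1 _) _ _)
    (fun K t ht τ hτ v hv y hy z κ hz _ =>
      osc_le_of_locReg_level L hLtwo ha₀ ha₁ hε₁ hε₁1 hsmall _ (hprof _).1 (hdictA K t ht τ hτ v hv y hy z hz) y.1 κ)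
    hwinA hwinB hwinBf (cReg_nonneg a₀ ha₁) (fun j => le_rfl) hα₁lev hreprU hreprL hε₁ hCl hϑ0 hϑ1
  exact goodClause_summable_of_kindsRA_lift hUR hCr hθ'0 hθ'1 hθ'Λ hΛ1 hCl hURB hEB₀ hURR hCrR hfmtA hfmtB hint hsc
    hoff hS hM hwit hvol hE ha0 ha1 hSle hpend hBwin hMB hnpos hzA hzB hzAs hzBs hq hrsc hMR hRSA hRSB hb h031A h031B
    hgsA hgsB hR₁ hκ₀ hminA hQ hlift hminB hact hw₀
    (fun K t ht τ hτ v hv => (hU K t ht τ hτ v hv).trans (mul_le_mul_of_nonneg_right hMvol (hU0 K)))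
    (fun K t ht τ hτ v hv => (hLd K t ht τ hτ v hv).trans (mul_le_mul_of_nonneg_right hMvol (hL0 K)))
    hU0 hL0 hUs hLs hγ hrγ hwpos hRw hRRw hrw hWw hsw

end Ledger

end Summit.QuantumFields.BalabanUV.T4Continuum.TermwiseLocal
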